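import Literature.InformationTheory.QuantumCodes.TwoBlockGroupAlgebraCodes
import Literature.InformationTheory.QuantumCodes.HypergraphProductSectorExact
import Literature.InformationTheory.QuantumCodes.HypergraphProductDimension
import Literature.InformationTheory.QuantumCodes.AbelianTwoBlockHypergraphProduct
import Literature.InformationTheory.QuantumCodes.GroupAlgebraCodeTransposeDistance
import HarnessLib

/-!
# Two-block group-algebra codes over a direct product `G_a × G_b` of ARBITRARY finite groups with separated
# supports ARE hypergraph products — with Tillich–Zémor's FOUR-distance formula (Lin–Pryadko 2024 §IV.C, corrected
# for non-abelian constituent groups)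

Topic `InformationTheory/QuantumCodes`; namespace `Literature.InformationTheory.QuantumCodes.TwoBlockGA`.
LADDER-QEC (cell `qec`), LIT-3 constructions, register A40/A41 (qec-lit-3 gen 6). 0 named facts, no `sorry`.

Source followed. H.-K. Lin, L. P. Pryadko, *Quantum two-block group algebra codes*, PRA **109** (2024) 022407 =
arXiv:2306.16400 [LinPryadko2024], §IV.C after Statement 8 (held text chunk p0010 L66–79):

> «In particular, with disjoint subgroups, `G_a ∩ G_b = {1}`, the group in Statement 8 is just a direct product of
> the two subgroups, `G' = G_a × G_b`. … both matrices may simultaneously have the form of Kronecker products,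
> `A = A₁ ⊗ I_{n_b}`, `B = I_{n_a} ⊗ B₁` … This is exactly the block structure of an HP code [Tillich-Zemor-2009],
> constructed from square matrices `A₁` and `B₁`. If we denote the parameters of classical linear codes with parity
> check matrices `A₁` and `B₁`, respectively, as `[n_a,k_a,d_a]_q` and `[n_b,k_b,d_b]_q` (these parameters remain
> the same when the transposed matrices are used), the parameters of the quantum HP code are known explicitly,
> `[[2n_an_b, 2k_ak_b, min(d_a,d_b)]]_q`.»

The abelian case is `AbelianTwoBlockHypergraphProduct.lean` (everything as printed, PROVED). Here `G₁`, `G₂` are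
ARBITRARY finite groups. What survives verbatim: the Kronecker structure (`leftMul_prodInl`, `rightMul_prodInr`), the
identification with `Q_{ℋ₁·ℋ₂}` for `H₁ = L(a)`, `H₂ = R(b)` (`css_prod_HX`, `css_prod_HZ`), the DIMENSIONS of the
transposed codes (`finrank_pcCode_transpose`, any square matrix) and hence `k = 2k_ak_b` (`css_prod_k`). What does
NOT survive is the parenthetical for DISTANCES: `d(ker L(a)ᵀ) ≠ d(ker L(a))` in general over a non-abelian group
(`GroupAlgebraCodeTransposeDistance.lean`: `4` vs `2` in `𝔽₂[D₆]`, and a `[[72,·,2]]` code where the printed formula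
gives `3`). The correct statement, typed here, is the tree's exact hypergraph-product formula (Zeng–Pryadko Thm 17 /
Tillich–Zémor Thm 9) with all four classical distances:

* `css_prod_cssMinDist` — `D = min( min(d_aᵀ·[k_b≠0], [k_a≠0]·d_bᵀ), min(d_a·[k_b≠0], [k_a≠0]·d_b) )` with
  `d_a = d(ker L(a))`, `d_aᵀ = d(ker L(a)ᵀ)`, `d_b = d(ker R(b))`, `d_bᵀ = d(ker R(b)ᵀ)`;
* ★ `css_prod_isCode` — for `k_a, k_b > 0`: **`LP[a ⊗ 1, 1 ⊗ b]` is a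
  `[[2 n_a n_b, 2 k_a k_b, min(d_a, d_aᵀ, d_b, d_bᵀ)]]` code** (census predicate `IsCode`, exact distance).

## References

* [LinPryadko2024] Lin–Pryadko, arXiv:2306.16400, §IV.C (chunk p0010 L66–79, quoted); §IV.A eq. (10) `L(a)`, `R(b)`.
* [TillichZemor2014] J.-P. Tillich, G. Zémor, IEEE Trans. Inf. Theory 60 (2014) 1193 = arXiv:0903.0566, Thm 7
  (dimension), Thm 9 / Lemma 10 (distance) — tree: `HypergraphProductDimension.lean`,
  `HypergraphProductSectorExact.lean` (`HypergraphProduct.cssMinDist_xMatrix_eq`, Zeng–Pryadko Thm 17).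
-/

namespace Literature.InformationTheory.QuantumCodes

open Matrix Module
open scoped Kronecker
open Literature.InformationTheory.Coding (minDist)

namespace TwoBlockGA

variable {G₁ G₂ : Type*} [Group G₁] [Group G₂]

/-! ### Separated supports on a direct product -/

/-- `a ⊗ 1 ∈ 𝔽₂[G₁ × G₂]`: `a ∈ 𝔽₂[G₁]` placed on the subgroup `G₁ × 1`. (definition)
[cite: LinPryadko2024, §IV.C «A = A₁ ⊗ I_{n_b}» (arXiv:2306.16400 chunk p0010 L69–72)] -/
def prodInl [DecidableEq G₂] (a : G₁ → ZMod 2) : G₁ × G₂ → ZMod 2 := fun g => if g.2 = 1 then a g.1 else 0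

/-- `1 ⊗ b ∈ 𝔽₂[G₁ × G₂]`: `b ∈ 𝔽₂[G₂]` placed on the subgroup `1 × G₂`. (definition)
[cite: LinPryadko2024, §IV.C «B = I_{n_a} ⊗ B₁» (arXiv:2306.16400 chunk p0010 L69–72)] -/
def prodInr [DecidableEq G₁] (b : G₂ → ZMod 2) : G₁ × G₂ → ZMod 2 := fun g => if g.1 = 1 then b g.2 else 0

omit [Group G₁] in
/-- [cite: LinPryadko2024, §IV.C (arXiv:2306.16400 chunk p0010 L69–72)] -/
@[simp] theorem prodInl_apply [DecidableEq G₂] (a : G₁ → ZMod 2) (g : G₁ × G₂) :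
    prodInl a g = if g.2 = 1 then a g.1 else 0 := rfl

omit [Group G₂] in
/-- [cite: LinPryadko2024, §IV.C (arXiv:2306.16400 chunk p0010 L69–72)] -/
@[simp] theorem prodInr_apply [DecidableEq G₁] (b : G₂ → ZMod 2) (g : G₁ × G₂) :
    prodInr b g = if g.1 = 1 then b g.2 else 0 := rfl

/-- **`L(a ⊗ 1) = L(a) ⊗ 1`** — for ARBITRARY groups. [cite: LinPryadko2024, §IV.C «A = A₁ ⊗ I_{n_b}» (arXiv:2306.16400 chunk p0010 L69–72)] -/
theorem leftMul_prodInl [DecidableEq G₁] [DecidableEq G₂] (a : G₁ → ZMod 2) :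
    leftMul (prodInl a) = leftMul a ⊗ₖ (1 : Matrix G₂ G₂ (ZMod 2)) := by
  ext ⟨g₁, g₂⟩ ⟨h₁, h₂⟩
  simp only [leftMul, of_apply, prodInl_apply, Prod.inv_mk, Prod.mk_mul_mk, mul_inv_eq_one, kroneckerMap_apply,
    one_apply]
  split_ifs <;> simp

/-- **`R(1 ⊗ b) = 1 ⊗ R(b)`** — for ARBITRARY groups. [cite: LinPryadko2024, §IV.C «B = I_{n_a} ⊗ B₁» (arXiv:2306.16400 chunk p0010 L69–72)] -/
theorem rightMul_prodInr [DecidableEq G₁] [DecidableEq G₂] (b : G₂ → ZMod 2) :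
    rightMul (prodInr b) = (1 : Matrix G₁ G₁ (ZMod 2)) ⊗ₖ rightMul b := by
  ext ⟨g₁, g₂⟩ ⟨h₁, h₂⟩
  simp only [rightMul, of_apply, prodInr_apply, Prod.inv_mk, Prod.mk_mul_mk, inv_mul_eq_one, kroneckerMap_apply,
    one_apply]
  split_ifs with h1 h2 h3 <;> simp_all [eq_comm]

variable [Fintype G₁] [Fintype G₂] [DecidableEq G₁] [DecidableEq G₂]

/-- **`H_X(LP[a ⊗ 1, 1 ⊗ b]) = H_X(Q_{ℋ₁·ℋ₂})` with `H₁ = L(a)`, `H₂ = R(b)`** — an equality of matrices.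
[cite: LinPryadko2024, §IV.C «This is exactly the block structure of an HP code» (arXiv:2306.16400 chunk p0010 L72–74)] -/
theorem css_prod_HX (a : G₁ → ZMod 2) (b : G₂ → ZMod 2) :
    (css (prodInl a) (prodInr b)).HX = HypergraphProduct.xMatrix (leftMul a) (rightMul b) := by
  rw [css_HX]
  unfold HX
  rw [leftMul_prodInl, rightMul_prodInr]
  rfl

/-- **`H_Z(LP[a ⊗ 1, 1 ⊗ b]) = H_Z(Q_{ℋ₁·ℋ₂})`** (`[Bᵀ|Aᵀ] = [1 ⊗ H₂ᵀ | H₁ᵀ ⊗ 1]`).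
[cite: LinPryadko2024, §IV.C (arXiv:2306.16400 chunk p0010 L72–74)] -/
theorem css_prod_HZ (a : G₁ → ZMod 2) (b : G₂ → ZMod 2) :
    (css (prodInl a) (prodInr b)).HZ = HypergraphProduct.zMatrix (leftMul a) (rightMul b) := by
  rw [css_HZ]
  unfold HZ
  rw [leftMul_prodInl, rightMul_prodInr, ← kroneckerMap_transpose, ← kroneckerMap_transpose, transpose_one,
    transpose_one]
  rfl

/-! ### Transposes: the DIMENSION is invariant (any square matrix); the distance is not (see
`GroupAlgebraCodeTransposeDistance.lean`) -/

section Transpose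

variable {ι : Type*} [Fintype ι]

omit [Fintype G₁] [Fintype G₂] [DecidableEq G₁] [DecidableEq G₂] [Group G₁] [Group G₂] in
/-- `dim ker Mᵀ = dim ker M` for a square matrix over `𝔽₂` (rank–nullity and `rank Mᵀ = rank M`).
[cite: LinPryadko2024, §IV.C «(these parameters remain the same when the transposed matrices are used)» (arXiv:2306.16400 chunk p0010 L76–77) — the dimension half, true for every square matrix] -/
theorem finrank_pcCode_transpose (M : Matrix ι ι (ZMod 2)) :
    finrank (ZMod 2) (pcCode Mᵀ) = finrank (ZMod 2) (pcCode M) := by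
  have h1 := LinearMap.finrank_range_add_finrank_ker M.mulVecLin
  have h2 := LinearMap.finrank_range_add_finrank_ker Mᵀ.mulVecLin
  have hr : finrank (ZMod 2) (LinearMap.range Mᵀ.mulVecLin) = finrank (ZMod 2) (LinearMap.range M.mulVecLin) := by
    rw [← Matrix.rank, ← Matrix.rank, Matrix.rank_transpose]
  unfold pcCode
  omega

omit [Fintype G₁] [Fintype G₂] [DecidableEq G₁] [DecidableEq G₂] [Group G₁] [Group G₂] in
/-- `ker Mᵀ = 0 ↔ ker M = 0` for a square matrix. [cite: LinPryadko2024, §IV.C (arXiv:2306.16400 chunk p0010 L76–77)] -/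
theorem pcCode_transpose_eq_bot_iff [DecidableEq ι] (M : Matrix ι ι (ZMod 2)) : pcCode Mᵀ = ⊥ ↔ pcCode M = ⊥ := by
  rw [← Submodule.finrank_eq_zero, ← Submodule.finrank_eq_zero, finrank_pcCode_transpose]

end Transpose

/-! ### Parameters -/

/-- **`k = 2 k_a k_b`** for `LP[a ⊗ 1, 1 ⊗ b]` over ANY `G₁ × G₂` (`k_a = dim ker L(a)`, `k_b = dim ker R(b)`), from
Tillich–Zémor's Theorem 7 and `finrank_pcCode_transpose`. [cite: LinPryadko2024, §IV.C «[[2n_an_b, 2k_ak_b, …]]» (arXiv:2306.16400 chunk p0010 L77–79)]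
[cite: TillichZemor2014, Thm 7 (arXiv:0903.0566v1 chunk p0007 L126–135)] -/
theorem css_prod_k (a : G₁ → ZMod 2) (b : G₂ → ZMod 2) :
    (css (prodInl a) (prodInr b)).k =
      2 * finrank (ZMod 2) (pcCode (leftMul a)) * finrank (ZMod 2) (pcCode (rightMul b)) := by
  have hk := (css (prodInl a) (prodInr b)).k_eq
  have hle := (css (prodInl a) (prodInr b)).rank_HX_add_rank_HZ_le
  rw [css_prod_HX, css_prod_HZ] at hk hle
  have hX := HypergraphProduct.rank_xMatrix_add (leftMul a) (rightMul b)
  have hZ := HypergraphProduct.rank_zMatrix_add (leftMul a) (rightMul b)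
  rw [finrank_pcCode_transpose, finrank_pcCode_transpose] at hX
  have hcard : Fintype.card ((G₁ × G₂) ⊕ (G₁ × G₂)) = 2 * (Fintype.card G₁ * Fintype.card G₂) := by
    simp only [Fintype.card_sum, Fintype.card_prod]; ring
  rw [hcard] at hk hle
  rw [hk, Nat.mul_assoc]
  omega

/-- **The CSS minimum distance of `LP[a ⊗ 1, 1 ⊗ b]` over ANY `G₁ × G₂`, EXACT — with all FOUR classical
distances:** `D = min( min(d_aᵀ·[k_b≠0], [k_a≠0]·d_bᵀ), min(d_a·[k_b≠0], [k_a≠0]·d_b) )`, where `d_a = d(ker L(a))`,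
`d_aᵀ = d(ker L(a)ᵀ)`, `d_b = d(ker R(b))`, `d_bᵀ = d(ker R(b)ᵀ)` (guards via `pcCode_transpose_eq_bot_iff`).
[cite: LinPryadko2024, §IV.C (arXiv:2306.16400 chunk p0010 L74–79) — the printed `min(d_a,d_b)` is the abelian case]
[cite: ZengPryadko2020, Thm 17 (arXiv:2007.12152 chunk p0018 L1-12)] [cite: TillichZemor2014, Thm 9 and Lemma 10 (arXiv v1 chunk p0008 L11-15, L53-62)] -/
theorem css_prod_cssMinDist (a : G₁ → ZMod 2) (b : G₂ → ZMod 2) :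
    cssMinDist (css (prodInl a) (prodInr b)).HX (css (prodInl a) (prodInr b)).HZ =
      min (min (⨅ (_ : pcCode (rightMul b) ≠ ⊥), minDist (pcCode (leftMul a)ᵀ))
               (⨅ (_ : pcCode (leftMul a) ≠ ⊥), minDist (pcCode (rightMul b)ᵀ)))
          (min (⨅ (_ : pcCode (rightMul b) ≠ ⊥), minDist (pcCode (leftMul a)))
               (⨅ (_ : pcCode (leftMul a) ≠ ⊥), minDist (pcCode (rightMul b)))) := by
  rw [css_prod_HX, css_prod_HZ, HypergraphProduct.cssMinDist_xMatrix_eq]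
  simp only [ne_eq, pcCode_transpose_eq_bot_iff]

/-- ★ **Lin–Pryadko §IV.C, corrected for arbitrary constituent groups: `LP[a ⊗ 1, 1 ⊗ b]` over `G₁ × G₂` is a
`[[2 n_a n_b, 2 k_a k_b, min(d_a, d_aᵀ, d_b, d_bᵀ)]]` code** when `k_a, k_b > 0` (census predicate `IsCode`, exact
distance). For abelian `G₁, G₂` the transposed distances coincide with `d_a, d_b` and this is the printed
`[[2n_an_b, 2k_ak_b, min(d_a,d_b)]]`; for non-abelian groups they need not
(`GroupAlgebraCodeTransposeDistance.lean`).
[cite: LinPryadko2024, §IV.C «the parameters of the quantum HP code are known explicitly, [[2n_an_b, 2k_ak_b, min(d_a,d_b)]]_q» (arXiv:2306.16400 chunk p0010 L77–79)] [cite: TillichZemor2014, Thm 9 (arXiv v1 chunk p0008 L11-15)] -/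
theorem css_prod_isCode (a : G₁ → ZMod 2) (b : G₂ → ZMod 2) {ka kb da daT db dbT : ℕ}
    (hka : finrank (ZMod 2) (pcCode (leftMul a)) = ka) (hkb : finrank (ZMod 2) (pcCode (rightMul b)) = kb)
    (hka0 : 0 < ka) (hkb0 : 0 < kb)
    (hda : minDist (pcCode (leftMul a)) = da) (hdaT : minDist (pcCode (leftMul a)ᵀ) = daT)
    (hdb : minDist (pcCode (rightMul b)) = db) (hdbT : minDist (pcCode (rightMul b)ᵀ) = dbT) :
    (css (prodInl a) (prodInr b)).IsCode (2 * Fintype.card G₁ * Fintype.card G₂) (2 * ka * kb)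
      (min (min daT dbT) (min da db)) := by
  refine ⟨AbelianTwoBlock.card_qubits_prod, by rw [css_prod_k, hka, hkb], ?_⟩
  have ha : pcCode (leftMul a) ≠ ⊥ := fun h0 => by
    rw [h0, finrank_bot] at hka; omega
  have hb : pcCode (rightMul b) ≠ ⊥ := fun h0 => by
    rw [h0, finrank_bot] at hkb; omega
  have hmin : ∀ x y : ℕ, ((min x y : ℕ) : ℕ∞) = min (x : ℕ∞) (y : ℕ∞) := fun x y => by
    rcases le_total x y with h | h
    · rw [min_eq_left h, min_eq_left (Nat.cast_le.2 h)]
    · rw [min_eq_right h, min_eq_right (Nat.cast_le.2 h)]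
  rw [css_prod_cssMinDist, iInf_pos hb, iInf_pos ha, iInf_pos hb, iInf_pos ha, hda, hdaT, hdb, hdbT, hmin, hmin,
    hmin]

/-! ### Cross-check (appended): the E-14 instance through the general formula

For `G₁ = D₆`, `a = a6` and `G₂ = ℤ₃`, `b = b3 = 1 + y` the general formula `css_prod_cssMinDist` evaluates to
`min(min(d_aᵀ, d_bᵀ), min(d_a, d_b)) = min(min(2, ·), min(4, ·)) ≤ 2`, and with `d_b, d_bᵀ ≥ 2` to exactly `2` —
the same value the direct certificate `LinPryadko2024_sec4C_hp_counterexample_dX_dZ` gives (`d_X = 2`, `d_Z = 3`),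
where the printed `min(d_a, d_b)` is `3`. -/

section CrossCheck

open DihedralGroup

/-- `b3 = 1 + y ∈ 𝔽₂[ℤ₃]`. [cite: LinPryadko2024, §IV.C (arXiv:2306.16400 chunk p0010 L74–79)] -/
def b3 : Multiplicative (ZMod 3) → ZMod 2 := fun y => if y = 1 ∨ y = Multiplicative.ofAdd 1 then 1 else 0

/-- `a36 = a6 ⊗ 1`, `b36 = 1 ⊗ b3` (the vectors of `GroupAlgebraCodeTransposeDistance.lean`). [folklore] -/
private theorem a36_eq : a36 = prodInl a6 ∧ b36 = prodInr b3 := by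
  refine ⟨rfl, funext fun g => ?_⟩
  simp only [b36, prodInr_apply, b3]
  split_ifs <;> simp_all

/-- `ker R(b3) ≠ 0` (the all-ones word) and `ker L(a6) ≠ 0`. [folklore] -/
private theorem pcCode_ne_bot : pcCode (rightMul b3) ≠ ⊥ ∧ pcCode (leftMul a6) ≠ ⊥ := by
  refine ⟨fun h => ?_, fun h => ?_⟩
  · have h1 : (fun _ => (1 : ZMod 2)) ∈ pcCode (rightMul b3) := (mem_pcCode_iff _ _).mpr (by decide)
    rw [h, Submodule.mem_bot] at h1
    exact one_ne_zero (congrFun h1 1)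
  · have h4 := minDist_pcCode_leftMul_a6
    rw [h, Coding.minDist_bot] at h4
    exact ENat.top_ne_coe 4 h4

/-- `d(ker R(b3)) ≥ 2` and `d(ker R(b3)ᵀ) ≥ 2` (no zero column). [folklore] -/
private theorem two_le_minDist_b3 :
    (2 : ℕ∞) ≤ minDist (pcCode (rightMul b3)) ∧ (2 : ℕ∞) ≤ minDist (pcCode (rightMul b3)ᵀ) := by
  have key : ∀ (M : Matrix (Multiplicative (ZMod 3)) (Multiplicative (ZMod 3)) (ZMod 2)),
      (∀ q, (fun i => M i q) ≠ 0) → (2 : ℕ∞) ≤ minDist (pcCode M) := by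
    intro M hcol
    rw [Coding.le_minDist_iff]
    intro c hc hc0
    rw [mem_pcCode_iff] at hc
    by_contra hlt
    push Not at hlt
    have hwt : hammingNorm c < 2 := by exact_mod_cast hlt
    have hpos : 0 < hammingNorm c := hammingNorm_pos_iff.mpr hc0
    -- weight one: `c` is the indicator of a single point `q`, so `M c` is column `q`
    obtain ⟨q, hq⟩ := Finset.card_eq_one.mp (show (Finset.univ.filter fun j => c j ≠ 0).card = 1 by
      have : (Finset.univ.filter fun j => c j ≠ 0).card = hammingNorm c := by simp [hammingNorm]
      omega)
    have hcq : ∀ j, c j = if j = q then 1 else 0 := by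
      intro j
      have hj : j ∈ (Finset.univ.filter fun j => c j ≠ 0) ↔ j ∈ ({q} : Finset _) := by rw [hq]
      simp only [Finset.mem_filter, Finset.mem_univ, true_and, Finset.mem_singleton] at hj
      by_cases hjq : j = q
      · rw [if_pos hjq]
        have hne : c j ≠ 0 := hj.mpr hjq
        revert hne; generalize c j = x; decide +revert
      · rw [if_neg hjq]
        by_contra hne
        exact hjq (hj.mp hne)
    refine hcol q (funext fun i => ?_)
    have := congrFun hc i
    rw [mulVec, dotProduct] at this
    simp only [hcq, mul_ite, mul_one, mul_zero, Finset.sum_ite_eq', Finset.mem_univ, if_true] at this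
    exact this
  exact ⟨key _ (by decide), key _ (by decide)⟩

/-- ★ **E-14 through the general theorem:** the CSS minimum distance of `LP[a6 ⊗ 1, 1 ⊗ (1+y)]` over `D₆ × ℤ₃`
computed by `css_prod_cssMinDist` (Tillich–Zémor / Zeng–Pryadko, four distances) is `2` — agreeing with the direct
kernel certificate (`d_X = 2`, `d_Z = 3`) and NOT with the printed `min(d_a, d_b) = min(4, 3) = 3`.
[cite: LinPryadko2024, §IV.C (arXiv:2306.16400 chunk p0010 L74–79)] -/
theorem cssMinDist_a36_b36 : cssMinDist (css a36 b36).HX (css a36 b36).HZ = 2 := by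
  obtain ⟨ha, hb⟩ := a36_eq
  rw [ha, hb, css_prod_cssMinDist, iInf_pos pcCode_ne_bot.1, iInf_pos pcCode_ne_bot.2, iInf_pos pcCode_ne_bot.1,
    iInf_pos pcCode_ne_bot.2, minDist_pcCode_leftMul_a6_transpose, minDist_pcCode_leftMul_a6]
  obtain ⟨h1, h2⟩ := two_le_minDist_b3
  apply le_antisymm
  · exact le_trans (min_le_left _ _) (min_le_left _ _)
  · refine le_min (le_min le_rfl h2) (le_min ?_ h1)
    decide

/-! #### `k = 12` by rank certificates, hence `[[72, 12, 2]]` exactly (appended)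

`k = 2 k_a k_b` (`css_prod_k`) with `k_a = dim ker L(a6) = 12 − rank L(a6) = 6` and `k_b = 3 − rank R(b3) = 1`, the two
ranks certified by explicit row-reduction data `U H = N`, `M N = H`, `N S = 1_r` checked by `decide` (the pattern
of `NonAbelianTwoBlockExampleA4.lean`). With `cssMinDist_a36_b36 = 2` this gives the census predicate
`IsCode 72 12 2` for the E-14 instance, against the printed `[[72, 12, 3]]`. -/

/-- Enumeration `D₆ → Fin 12`: `r i ↦ i`, `sr i ↦ 6 + i`. (plumbing) [folklore] -/
private def code12 : DihedralGroup 6 → Fin 12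
  | r i => Fin.castAdd 6 i
  | sr i => Fin.natAdd 6 i

/-- Row-reduction data for `L(a6)` (rank 6): `U`. (plumbing) [folklore] -/
private def UAtab : Fin 6 → Fin 12 → ZMod 2 :=
  ![![0, 1, 1, 0, 0, 1, 0, 0, 0, 0, 0, 0], ![1, 0, 1, 1, 0, 0, 0, 0, 0, 0, 0, 0], ![0, 1, 0, 1, 1, 0, 0, 0, 0, 0, 0, 0],
    ![0, 0, 1, 0, 1, 1, 0, 0, 0, 0, 0, 0], ![1, 0, 0, 1, 0, 1, 0, 0, 0, 0, 0, 0], ![1, 1, 0, 0, 1, 0, 0, 0, 0, 0, 0, 0]]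
/-- `N` = the reduced row-echelon form of `L(a6)`. (plumbing) [folklore] -/
private def NAtab : Fin 6 → Fin 12 → ZMod 2 :=
  ![![1, 0, 0, 0, 0, 0, 1, 1, 0, 1, 1, 1], ![0, 1, 0, 0, 0, 0, 1, 1, 1, 0, 1, 1], ![0, 0, 1, 0, 0, 0, 1, 1, 1, 1, 0, 1],
    ![0, 0, 0, 1, 0, 0, 1, 1, 1, 1, 1, 0], ![0, 0, 0, 0, 1, 0, 0, 1, 1, 1, 1, 1], ![0, 0, 0, 0, 0, 1, 1, 0, 1, 1, 1, 1]]
/-- `M` with `M N = L(a6)`. (plumbing) [folklore] -/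
private def MAtab : Fin 12 → Fin 6 → ZMod 2 :=
  ![![1, 0, 0, 1, 0, 1], ![1, 1, 0, 0, 1, 0], ![0, 1, 1, 0, 0, 1], ![1, 0, 1, 1, 0, 0], ![0, 1, 0, 1, 1, 0],
    ![0, 0, 1, 0, 1, 1], ![1, 0, 1, 1, 0, 0], ![0, 1, 0, 1, 1, 0], ![0, 0, 1, 0, 1, 1], ![1, 0, 0, 1, 0, 1],
    ![1, 1, 0, 0, 1, 0], ![0, 1, 1, 0, 0, 1]]
/-- [folklore] -/
private def UA : Matrix (Fin 6) (DihedralGroup 6) (ZMod 2) := fun i g => UAtab i (code12 g)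
/-- [folklore] -/
private def NA : Matrix (Fin 6) (DihedralGroup 6) (ZMod 2) := fun i g => NAtab i (code12 g)
/-- [folklore] -/
private def MA : Matrix (DihedralGroup 6) (Fin 6) (ZMod 2) := fun g j => MAtab (code12 g) j
/-- Pivot selector (pivots `r 0, …, r 5`). [folklore] -/
private def SA : Matrix (DihedralGroup 6) (Fin 6) (ZMod 2) := fun g j => if code12 g = Fin.castAdd 6 j then 1 else 0

/-- Row-reduction data for `R(b3)` (rank 2). [folklore] -/
private def UB : Matrix (Fin 2) (Multiplicative (ZMod 3)) (ZMod 2) :=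
  fun i y => (![![1, 0, 0], ![1, 1, 0]] : Fin 2 → Fin 3 → ZMod 2) i (Multiplicative.toAdd y)
/-- [folklore] -/
private def NB : Matrix (Fin 2) (Multiplicative (ZMod 3)) (ZMod 2) :=
  fun i y => (![![1, 0, 1], ![0, 1, 1]] : Fin 2 → Fin 3 → ZMod 2) i (Multiplicative.toAdd y)
/-- [folklore] -/
private def MB : Matrix (Multiplicative (ZMod 3)) (Fin 2) (ZMod 2) :=
  fun y j => (![![1, 0], ![1, 1], ![0, 1]] : Fin 3 → Fin 2 → ZMod 2) (Multiplicative.toAdd y) j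
/-- [folklore] -/
private def SB : Matrix (Multiplicative (ZMod 3)) (Fin 2) (ZMod 2) :=
  fun y j => if (Multiplicative.toAdd y : Fin 3) = Fin.castAdd 1 j then 1 else 0

set_option maxRecDepth 200000 in
/-- Certificate identities for `L(a6)`. [folklore] -/
private theorem A6_cert : UA * leftMul a6 = NA ∧ MA * NA = leftMul a6 ∧ NA * SA = 1 := by
  refine ⟨?_, ?_, ?_⟩ <;> decide

set_option maxRecDepth 200000 in
/-- Certificate identities for `R(b3)`. [folklore] -/
private theorem B3_cert : UB * rightMul b3 = NB ∧ MB * NB = rightMul b3 ∧ NB * SB = 1 := by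
  refine ⟨?_, ?_, ?_⟩ <;> decide

/-- The rank-from-certificate argument: `U H = N`, `M N = H`, `N S = 1_r ⟹ rank H = r`. [folklore] -/
private theorem rank_eq_of_cert {m n : Type*} [Fintype m] [Fintype n] [DecidableEq n] {r : ℕ}
    {H : Matrix m n (ZMod 2)} {U : Matrix (Fin r) m (ZMod 2)} {M : Matrix m (Fin r) (ZMod 2)}
    {N : Matrix (Fin r) n (ZMod 2)} {S : Matrix n (Fin r) (ZMod 2)}
    (h1 : U * H = N) (h2 : M * N = H) (h3 : N * S = 1) : H.rank = r := by
  apply le_antisymm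
  · calc H.rank = (M * N).rank := by rw [h2]
      _ ≤ N.rank := Matrix.rank_mul_le_right _ _
      _ ≤ Fintype.card (Fin r) := Matrix.rank_le_card_height _
      _ = r := Fintype.card_fin r
  · calc r = (1 : Matrix (Fin r) (Fin r) (ZMod 2)).rank := by rw [Matrix.rank_one, Fintype.card_fin]
      _ = (N * S).rank := by rw [h3]
      _ ≤ N.rank := Matrix.rank_mul_le_left _ _
      _ = (U * H).rank := by rw [h1]
      _ ≤ H.rank := Matrix.rank_mul_le_right _ _

/-- `dim ker M + rank M = n` (rank–nullity). [folklore] -/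
private theorem finrank_pcCode_add_rank {ι : Type*} [Fintype ι] (M : Matrix ι ι (ZMod 2)) :
    finrank (ZMod 2) (pcCode M) + M.rank = Fintype.card ι := by
  have h := LinearMap.finrank_range_add_finrank_ker M.mulVecLin
  rw [Matrix.rank]
  unfold pcCode
  rw [Module.finrank_fintype_fun_eq_card] at h
  omega

/-- `k_a = dim ker L(a6) = 6` and `k_b = dim ker R(b3) = 1`. [cite: LinPryadko2024, §IV.C «[n_a,k_a,d_a]_q and [n_b,k_b,d_b]_q» (arXiv:2306.16400 chunk p0010 L74–77)] -/
theorem finrank_pcCode_a6_b3 :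
    finrank (ZMod 2) (pcCode (leftMul a6)) = 6 ∧ finrank (ZMod 2) (pcCode (rightMul b3)) = 1 := by
  have hA := finrank_pcCode_add_rank (leftMul a6)
  have hB := finrank_pcCode_add_rank (rightMul b3)
  rw [rank_eq_of_cert A6_cert.1 A6_cert.2.1 A6_cert.2.2] at hA
  rw [rank_eq_of_cert B3_cert.1 B3_cert.2.1 B3_cert.2.2] at hB
  have h12 : Fintype.card (DihedralGroup 6) = 12 := by rw [DihedralGroup.card]
  have h3 : Fintype.card (Multiplicative (ZMod 3)) = 3 := by simp
  omega

/-- **`k = 12 = 2 k_a k_b`** for `LP[a6 ⊗ 1, 1 ⊗ (1+y)]` over `D₆ × ℤ₃` (as printed — the dimension half is right).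
[cite: LinPryadko2024, §IV.C «2k_ak_b» (arXiv:2306.16400 chunk p0010 L77–79)] -/
theorem k_a36_b36 : (css a36 b36).k = 12 := by
  obtain ⟨ha, hb⟩ := a36_eq
  rw [ha, hb, css_prod_k, finrank_pcCode_a6_b3.1, finrank_pcCode_a6_b3.2]

/-- ★ **E-14, census predicate: `LP[a6 ⊗ 1, 1 ⊗ (1+y)]` over `D₆ × ℤ₃` IS a `[[72, 12, 2]]` code** — where
[LinPryadko2024, §IV.C]'s formula `[[2n_an_b, 2k_ak_b, min(d_a,d_b)]]` gives `[[72, 12, 3]]`.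
[cite: LinPryadko2024, §IV.C (arXiv:2306.16400 chunk p0010 L74–79) — the distance entry REFUTED for this non-abelian instance, the `n` and `k` entries confirmed] -/
theorem isCode_a36_b36 : (css a36 b36).IsCode 72 12 2 :=
  ⟨by simp [Fintype.card_sum, Fintype.card_prod, DihedralGroup.card], k_a36_b36, cssMinDist_a36_b36⟩

end CrossCheck

end TwoBlockGA

end Literature.InformationTheory.QuantumCodes
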